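/-
Copyright (c) 2026 the pub-hodgecm-mathlib formalisation cell (harness21).  Prover seat hodgecm-mathlib-K2Liu-p05 (g0): Track B «K2-LIT»,
#184♮ = hLiu418 = stmt-HodgeConjecture-24832; socket #32d `sig_K2LiuDoublingHeightDecayLocal` of `Cruxes/HLiu418/Lines/K2_Liu_CurveThetaSigs_U5d_ZetaS.lean`
(ED. 1 a836627a4002dcd3 :224) — second step shared by the finite slice organs ((Bv-split), (Bv-nonsplit)); K2/STATUS 2026-09-04 (K2Liu-p05 (g0)).
-/
import Summits.HodgeConjecture.HodgeConjecture.Theorems.K2LiuDoublingHeckeCartanSum   -- ★ (K2Liu-p04): `IsCartanFamily` partition lemmas, `measurableSet_doubleCoset`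
import Mathlib.MeasureTheory.Function.L1Space.Integrable
import HarnessLib

/-!
# Crux `HLiu418`, road `K2_Liu`, unit U5d, socket #32d — THE CARTAN BOUND: integrability of a quasi-bi-invariant function from its Cartan series

Cell `hodgecm-mathlib`, crux item hLiu418 = `stmt-HodgeConjecture-24832`; squad K2 ∕ K2Liu, LEAD F0P6-plan (g10), planner K2Liu-plan (g2), prover
K2Liu-p05 (g0).  THEOREMS ONLY (no `def` ∕ instance ∕ notation ∕ named-fact hypothesis ∕ `sorry`, default heartbeats); lane
`--supports stmt-HodgeConjecture-24832 --as helper` (count-neutral).  GENERIC measure theory (any measurable group).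

After ★ `K2LiuDoublingHeightDecayLocalOfSlices` (#32d ⇐ its one-place slices) and ★ `K2LiuDoublingHeightSliceQuasiInvariance` (each slice `ψ` is
quasi-bi-invariant: `ψ(k g k′) ≤ c ψ(g)` for `k, k′` in a compact open `K`), the finite slice at `v` is integrable as soon as its CARTAN SERIES
`∑_a ν(K t_a K) ψ(t_a)` converges, for any ★ D7d `IsCartanFamily K t` (`G = ⊔_a K t_a K` disjointly — ★ `isCartanFamily_localInt_split` at split places).
This file is that step ([GelbartPiatetskishapiroRallis1987, Part A §6]; [Li1992, §3 Thm. 3.1]; [Macdonald1995, Ch. V (2.9)]):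

* `lintegral_le_tsum_of_quasiInvariant` — `∫⁻ ψ dν ≤ ∑_a ENNReal.ofReal (c ψ(t_a)) · ν(K t_a K)` (★ `iUnion_doubleCoset_eq_univ`, ★ `pairwise_disjoint_doubleCoset`,
  Mathlib `lintegral_iUnion`, and `ψ ≤ c ψ(t_a)` on `K t_a K`);
* **`integrable_of_cartanSeries`** — `ψ ≥ 0` a.e.-strongly measurable and quasi-bi-invariant under `K`, the double cosets measurable of finite measure,
  `∑_a ν(K t_a K)·ψ(t_a) < ∞` ⟹ `Integrable ψ ν`; `integrable_of_cartanSeries_of_isOpen` — the same with measurability from an open `K`.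

HONEST LABEL.  Count-neutral helper (second step of the finite slice organs of #32d; it pays nothing by itself — the Cartan series themselves, i.e. the
evaluation `ψ(t_a) ≍ q^{−Σ|a_i|∕2}` and the volume growth `ν(K t_a K) ≲ q^{⟨2ρ,a⟩}`, are the remaining organs): `HC_CM` is proved only modulo the 7 printed
citations (2 remaining named inputs: hLiu418 = `stmt-HodgeConjecture-24832`, h413 = `stmt-HodgeConjecture-24833`) until rung 0 closes.
References: [GelbartPiatetskishapiroRallis1987] LNM 1254, Part A §6; [Li1992] J. reine angew. Math. 428, §3 Thm. 3.1; [Macdonald1995] *Symmetric functions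
and Hall polynomials*, Ch. V (2.9); [CartierCorvallis1979] PSPM 33.1, §IV.2 (Cartan decomposition).
-/

set_option autoImplicit false
-- the mandated namespace repeats the single-problem summit's segment (`HodgeConjecture.HodgeConjecture`)
set_option linter.dupNamespace false

noncomputable section

open scoped ENNReal
open MeasureTheory

namespace Summit.HodgeConjecture.HodgeConjecture.Cruxes.HLiu418.K2LiuDoublingHeightSliceCartanBound

open Literature.NumberTheory.K2Lit.SiegelDoubled
open Summit.HodgeConjecture.HodgeConjecture.Cruxes.HLiu418.K2LiuDoublingHeckeCartanSum

variable {G : Type} [Group G] [MeasurableSpace G] {ι : Type} [Countable ι]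

omit [MeasurableSpace G] [Countable ι] in
/-- on the double coset `K t K` a quasi-bi-invariant function is at most `c ψ(t)`. [cite: Li1992, §3 Thm. 3.1] -/
theorem le_of_mem_doubleCoset {K : Subgroup G} {ψ : G → ℝ} {c : ℝ} (hquasi : ∀ x ∈ K, ∀ y ∈ K, ∀ g : G, ψ (x * g * y) ≤ c * ψ g)
    {a g : G} (hg : g ∈ DoubleCoset.doubleCoset a (K : Set G) K) : ψ g ≤ c * ψ a := by
  obtain ⟨x, hx, y, hy, rfl⟩ := DoubleCoset.mem_doubleCoset.1 hg
  exact hquasi x hx y hy a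

/-- **`∫⁻ ψ dν ≤ ∑_a ofReal(c ψ(t_a)) · ν(K t_a K)`** for `ψ` quasi-bi-invariant under `K` along a Cartan family `t` with measurable double cosets.
[cite: GelbartPiatetskishapiroRallis1987, Part A §6] [cite: Li1992, §3 Thm. 3.1] -/
theorem lintegral_le_tsum_of_quasiInvariant (ν : Measure G) {K : Subgroup G} {t : ι → G} (ht : IsCartanFamily K t)
    (hm : ∀ i, MeasurableSet (DoubleCoset.doubleCoset (t i) (K : Set G) K))
    {ψ : G → ℝ} {c : ℝ} (hquasi : ∀ x ∈ K, ∀ y ∈ K, ∀ g : G, ψ (x * g * y) ≤ c * ψ g) :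
    ∫⁻ g, ENNReal.ofReal (ψ g) ∂ν ≤ ∑' i, ENNReal.ofReal (c * ψ (t i)) * ν (DoubleCoset.doubleCoset (t i) (K : Set G) K) := by
  have hcover : ∫⁻ g, ENNReal.ofReal (ψ g) ∂ν = ∫⁻ g in ⋃ i, DoubleCoset.doubleCoset (t i) (K : Set G) K, ENNReal.ofReal (ψ g) ∂ν := by
    rw [iUnion_doubleCoset_eq_univ ht, Measure.restrict_univ]
  rw [hcover, lintegral_iUnion hm (pairwise_disjoint_doubleCoset ht)]
  refine ENNReal.tsum_le_tsum fun i => ?_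
  calc ∫⁻ g in DoubleCoset.doubleCoset (t i) (K : Set G) K, ENNReal.ofReal (ψ g) ∂ν
      ≤ ∫⁻ _ in DoubleCoset.doubleCoset (t i) (K : Set G) K, ENNReal.ofReal (c * ψ (t i)) ∂ν :=
        setLIntegral_mono measurable_const fun g hg => ENNReal.ofReal_le_ofReal (le_of_mem_doubleCoset hquasi hg)
    _ = ENNReal.ofReal (c * ψ (t i)) * ν (DoubleCoset.doubleCoset (t i) (K : Set G) K) := setLIntegral_const _ _

/-- **THE CARTAN BOUND.**  Let `t` be a Cartan family for `K ≤ G` (`G = ⊔_a K t_a K`) with measurable double cosets of finite `ν`-measure, and `ψ ≥ 0`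
a.e.-strongly measurable with `ψ(k g k′) ≤ c ψ(g)` for `k, k′ ∈ K`.  If the Cartan series `∑_a ν(K t_a K)·ψ(t_a)` converges then `ψ` is `ν`-integrable
(`∫ ψ ≤ c ∑_a ν(K t_a K) ψ(t_a)`). [cite: GelbartPiatetskishapiroRallis1987, Part A §6] [cite: Li1992, §3 Thm. 3.1] [cite: Macdonald1995, Ch. V (2.9)] -/
theorem integrable_of_cartanSeries (ν : Measure G) {K : Subgroup G} {t : ι → G} (ht : IsCartanFamily K t)
    (hm : ∀ i, MeasurableSet (DoubleCoset.doubleCoset (t i) (K : Set G) K))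
    (hfin : ∀ i, ν (DoubleCoset.doubleCoset (t i) (K : Set G) K) ≠ ∞)
    {ψ : G → ℝ} (hψm : AEStronglyMeasurable ψ ν) (hψ0 : ∀ g, 0 ≤ ψ g)
    {c : ℝ} (hc : 0 ≤ c) (hquasi : ∀ x ∈ K, ∀ y ∈ K, ∀ g : G, ψ (x * g * y) ≤ c * ψ g)
    (hsum : Summable fun i => (ν (DoubleCoset.doubleCoset (t i) (K : Set G) K)).toReal * ψ (t i)) :
    Integrable ψ ν := by
  refine ⟨hψm, (hasFiniteIntegral_iff_ofReal (Filter.Eventually.of_forall hψ0)).2 ?_⟩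
  refine lt_of_le_of_lt (lintegral_le_tsum_of_quasiInvariant ν ht hm hquasi) ?_
  -- the bound is `ofReal` of the convergent real series `c ∑_a ν(K t_a K) ψ(t_a)`
  have hterm : ∀ i, ENNReal.ofReal (c * ψ (t i)) * ν (DoubleCoset.doubleCoset (t i) (K : Set G) K) =
      ENNReal.ofReal (c * ψ (t i) * (ν (DoubleCoset.doubleCoset (t i) (K : Set G) K)).toReal) := fun i => by
    rw [ENNReal.ofReal_mul (mul_nonneg hc (hψ0 _)), ENNReal.ofReal_toReal (hfin i)]
  have hnn : ∀ i, 0 ≤ c * ψ (t i) * (ν (DoubleCoset.doubleCoset (t i) (K : Set G) K)).toReal :=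
    fun i => mul_nonneg (mul_nonneg hc (hψ0 _)) ENNReal.toReal_nonneg
  have hsum' : Summable fun i => c * ψ (t i) * (ν (DoubleCoset.doubleCoset (t i) (K : Set G) K)).toReal :=
    (hsum.mul_left c).congr fun i => by ring
  rw [tsum_congr hterm, ← ENNReal.ofReal_tsum_of_nonneg hnn hsum']
  exact ENNReal.ofReal_lt_top

/-- the Cartan bound with measurability of the double cosets from an OPEN `K` in a topological group (★ `measurableSet_doubleCoset`).
[cite: Li1992, §3 Thm. 3.1] [cite: CartierCorvallis1979, §IV.2] -/
theorem integrable_of_cartanSeries_of_isOpen [TopologicalSpace G] [IsTopologicalGroup G] [BorelSpace G] (ν : Measure G)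
    {K : Subgroup G} (hK : IsOpen (K : Set G)) {t : ι → G} (ht : IsCartanFamily K t)
    (hfin : ∀ i, ν (DoubleCoset.doubleCoset (t i) (K : Set G) K) ≠ ∞)
    {ψ : G → ℝ} (hψm : AEStronglyMeasurable ψ ν) (hψ0 : ∀ g, 0 ≤ ψ g)
    {c : ℝ} (hc : 0 ≤ c) (hquasi : ∀ x ∈ K, ∀ y ∈ K, ∀ g : G, ψ (x * g * y) ≤ c * ψ g)
    (hsum : Summable fun i => (ν (DoubleCoset.doubleCoset (t i) (K : Set G) K)).toReal * ψ (t i)) :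
    Integrable ψ ν :=
  integrable_of_cartanSeries ν ht (fun i => measurableSet_doubleCoset hK (t i)) hfin hψm hψ0 hc hquasi hsum

end Summit.HodgeConjecture.HodgeConjecture.Cruxes.HLiu418.K2LiuDoublingHeightSliceCartanBound

end
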